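import Summits.AtomisticToContinuum.BoseEinsteinCondensation.Theorems.BECThomsonPrincipleGDTransferSeededRoughDefs
import Summits.AtomisticToContinuum.BoseEinsteinCondensation.Theorems.BECPhaseQuadratureSumRuleSmoothPartner
import Summits.AtomisticToContinuum.BoseEinsteinCondensation.Theorems.BECConjugateDominationHardCoreExtensionNearMinTowerNecessity

/-!
# Route `BECThomsonPrinciple`, crux `GDTransfer` (stmt-AtomisticToContinuum-9482), line `seeded-continuity`:
# two kernel-checked certificates on the essentially rough stub `stub_essentiallyRough` (lead c2 + recon worker)

Supports (does not close) stmt-AtomisticToContinuum-9482.  No new definitions; no Theses statement is asserted.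

* `essentiallyRough_of_periodicScatteringLengthTransfer` — the registered stub `Sig.stub_essentiallyRough`
  follows (Gaussian domination and the seed UNUSED) from the TORUS TWIN of the shared Dirichlet crux
  `BECEqualScatteringTransfer.ScatteringLengthTransfer` (stmt-9048), spelled inline: for admissible bounded `v`
  and admissible `w` of equal scattering length, near-minimiser periodic BEC transfers from `v` to `w`.  The
  finite continuous partner of the rough `w` is the landed `Theorems.smoothPartner_proof` (stmt-12628).
* `essentiallyRough_towerResidue_iff` — for every admissible `v`, level-uniform near-minimiser BEC along the
  truncation tower `min(v, n)` is EQUIVALENT to `PeriodicBECFor v` (the landed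
  `NearMinTower.nearMinimiserTowerBEC_iff_periodicBEC`, read in the line's vocabulary): an inherited-GD /
  truncation proof of the stub is no cheaper than its conclusion at the rough potential itself.

References: LSSY2005 Ch. 2 (after (2.8)) and Ch. 5 p. 42; B. Simon, J. Operator Theory 1 (1979) 37–47.
-/

noncomputable section

open MeasureTheory Filter
open scoped ENNReal NNReal

namespace Summit.AtomisticToContinuum.BoseEinsteinCondensation.Cruxes.GDTransfer.Seeded

open Literature.MathematicalPhysics.QuantumManyBody.BoseGas
open Summit.AtomisticToContinuum.BoseEinsteinCondensation.Theses.BECThomsonPrinciple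
open Summit.AtomisticToContinuum.BoseEinsteinCondensation.Cruxes.GDTransfer.DysonDressedWitness (PeriodicBECFor)

/-- **The essentially rough stub from the torus twin of `ScatteringLengthTransfer`** (stmt-9048 read for
near-minimiser periodic BEC): given the soft conclusion, a rough `w` inherits `PeriodicBECFor` from its bounded
smooth-class partner of equal scattering length (`Theorems.smoothPartner_proof`); Gaussian domination and the seed
are not used. [cite: LSSY2005, Ch. 2 after (2.8)] -/
theorem essentiallyRough_of_periodicScatteringLengthTransfer : (∀ v w : ℝ → ENNReal, IsRepulsiveFiniteRange v → IsRepulsiveFiniteRange w → (∃ M : NNReal, ∀ r, v r ≤ M) → scatteringLength v = scatteringLength w → PeriodicBECFor v → PeriodicBECFor w) → Sig.stub_essentiallyRough := by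
  intro hT _ _ hsoft w hw _
  obtain ⟨v, hv, hfin, hC2, -, hbdd, ha⟩ := Theorems.smoothPartner_proof w hw
  exact hT v w hv hw hbdd ha (hsoft v hv ⟨hfin, hC2.continuous⟩)

/-- **Tower residue ≡ conclusion, in the line's vocabulary**: for every admissible `v`, near-minimiser BEC along
the truncation tower `min(v, n)` with level-uniform constants is equivalent to `PeriodicBECFor v`
(`NearMinTower.nearMinimiserTowerBEC_iff_periodicBEC`). [cite: LSSY2005, Ch. 5 p. 42] -/
theorem essentiallyRough_towerResidue_iff (v : ℝ → ℝ≥0∞) (hv : IsRepulsiveFiniteRange v) :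
    (∃ ρ₀ : ℝ, 0 < ρ₀ ∧ ∀ ρ : ℝ, 0 < ρ → ρ < ρ₀ → ∃ c : ℝ, 0 < c ∧ ∀ᶠ N : ℕ in atTop,
        ∃ δ : ℝ≥0∞, 0 < δ ∧ ∃ n₀ : ℕ, ∀ n : ℕ, n₀ ≤ n →
          ∀ Ψ : PeriodicTrialState N (sideLength ρ N),
            periodicEnergy (fun r => min (v r) (n : ℝ≥0∞)) Ψ ≤
                periodicGroundStateEnergy (fun r => min (v r) (n : ℝ≥0∞)) N (sideLength ρ N) + δ →
              ENNReal.ofReal (c * N) ≤ condensateOccupation N (sideLength ρ N) Ψ.ψ) ↔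
      PeriodicBECFor v :=
  HardCoreExtension.NearMinTower.nearMinimiserTowerBEC_iff_periodicBEC v hv

end Summit.AtomisticToContinuum.BoseEinsteinCondensation.Cruxes.GDTransfer.Seeded

end
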